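import Mathlib
import HarnessLib
import Literature.NumberTheory.DiophantineApproximation.ClassPrimeProductRate
import Summits.KontsevichZagierPeriods.Zeta5Search.Denom.TwoTaleP15Saving

/-!
# Rung A — the φ-only saving at the cone point (α | β) = (6,5,4,7 | 0,1,2,12) (Zudilin 2014, Remark 3)

HONEST FRAMING: systematic search; no irrationality claim unless certified.  This file is the DENOMINATOR side of
fam-measure's "rung A" (families/measure/FAMILY.md §10.5): the first kernel target on the ladder to a certified measure of
`ζ(2)`, at the point `a = (6n+1, 5n+1, 4n+1, 7n+1)`, `b = (1, n+1, 2n+1, 12n+2)` of Zudilin's construction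
(arXiv:1310.1526, §3; the multiset of [Zudilin2014ZetaTwo, Remark 3] in its cone pairing), whose arithmetic is the
FIRST TALE ONLY (Lemma 7, `φ`; no second tale, no missing brick): normaliser `D₇ₙ²` (`γ₁ = γ₂ = 7`), class primes
`√(8n) < p ≤ 7n` (`γ₀ = 8`), and the digit function `φ ≤ 2` with
`{φ ≥ 1} = [1/7,1/6) ∪ [1/5,1/2) ∪ [3/5,7/8)`, `{φ = 2} = [1/5,1/4) ∪ [2/5,1/2) ∪ [3/5,5/8) ∪ [4/5,5/6)`
(Lemma 7's `S₄`-max and Remark 2's `min_y` count agree cell by cell; fam-denom `code/denom/p15/digits.py 6 5 4 7 1 2 12`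
= fam-measure `scan_mu7_cone.py`).  The printed measure at this point is `μ(ζ(2)) ≤ 5.20514736…` [Zudilin2014ZetaTwo,
Remark 3] — NOT a record; the interest is that every input here is elementary.

PROVED here (pattern of `TwoTaleP15Saving`, whose telescoping lemma is reused; the tail sandwich is re-proved ONCE in
generic form `densGap_tail_sandwich` over an arbitrary interval `0 < u < v ≤ u+1`):
* `savingProductA n = ∏_{i<7} ∏ {p prime : p ≤ 7n, 8n < p², uᵢ ≤ {n/p} < vᵢ} = ∏_{√(8n)<p≤7n} p^{φ(n/p)}`;
* `tendsto_log_savingProductA_div : (1/n) log Φₙ → savingRateA = Σᵢ (ψ(vᵢ) − ψ(uᵢ))`;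
* `tendsto_log_lcmNormaliserA_div : (1/n) log (D₇ₙ²/Φₙ) → 14 − savingRateA`;
* **`savingRateA_bounds : 6.91559 ≤ savingRateA ≤ 6.9157`** (`K = 10` partial sums; model value `6.91563523…`).
NOT here: the forms `qₙ, pₙ` at this point (successor file `TwoTaleR3Forms`, best built on the tree's general
`Zudilin2014.formQ/formP`), the inclusions `Φₙ ∣ D₇ₙ² qₙ`, `Φₙ⁻¹D₇ₙ² pₙ ∈ ℤ` (Lemma 7), decay `C₀ = 13.22912875…` and growth
`C₁ = 18.75527331…` (fam-measure §10.5, DESIGN-GRADE).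
-/

noncomputable section

open Filter Topology Finset
open Literature.NumberTheory.DiophantineApproximation
open Literature.NumberTheory.DiophantineApproximation.RhinViola
open Summit.KontsevichZagierPeriods.Zeta5Search.Denom.TwoTaleP15Saving

namespace Summit.KontsevichZagierPeriods.Zeta5Search.Denom.TwoTaleR3Saving

/-! ### Generic enclosure machinery for one interval `[u, v)` -/

/-- The density term `1/(k+u) − 1/(k+v)` of an interval `[u,v)`. -/
def densGap (u v : ℝ) (k : ℕ) : ℝ := 1 / ((k : ℝ) + u) - 1 / ((k : ℝ) + v)

/-- Summability of the density terms (tree: `RhinViola.summable_densityTerm`). -/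
theorem summable_densGap {u v : ℝ} (hu : 0 < u) (huv : u < v) (hv1 : v ≤ u + 1) : Summable (densGap u v) :=
  summable_densityTerm hu huv.le hv1

/-- **Generic tail sandwich.** For `0 < u < v ≤ u+1`, `K ≥ 1`, `m = (u+v)/2`:
`(v−u)/(K+m−½+1/(8K)) ≤ Σ_{k≥K} (1/(k+u) − 1/(k+v)) ≤ (v−u)/(K+m−½)`. -/
theorem densGap_tail_sandwich {u v : ℝ} (hu0 : 0 < u) (huv : u < v) (hv1 : v ≤ u + 1) (K : ℕ) (hK : 0 < K) :
    (v - u) * (1 / ((K : ℝ) + (u + v) / 2 - 1 / 2 + 1 / (8 * K))) ≤ ∑' k : ℕ, densGap u v (k + K) ∧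
      ∑' k : ℕ, densGap u v (k + K) ≤ (v - u) * (1 / ((K : ℝ) + (u + v) / 2 - 1 / 2)) := by
  have hv0 : 0 < v := hu0.trans huv
  have hvu0 : 0 < v - u := sub_pos.2 huv
  have hw : (v - u) * (v - u) ≤ 1 := by nlinarith
  have hK1 : (1 : ℝ) ≤ K := by exact_mod_cast hK
  have hf : HasSum (fun k : ℕ => densGap u v (k + K)) (∑' k : ℕ, densGap u v (k + K)) :=
    ((summable_nat_add_iff K).2 (summable_densGap hu0 huv hv1)).hasSum
  set s : ℝ := 1 / (8 * K) with hs
  have hs0 : 0 < s := by positivity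
  have hsK : s * K = 1 / 8 := by rw [hs]; field_simp
  set a : ℝ := (K : ℝ) + (u + v) / 2 - 1 / 2 + s with ha
  set b : ℝ := (K : ℝ) + (u + v) / 2 - 1 / 2 with hb
  have ha0 : 0 < a := by rw [ha]; linarith
  have hb0 : 0 < b := by rw [hb]; linarith
  have hga := (hasSum_shiftedTelescope ha0).mul_left (v - u)
  have hgb := (hasSum_shiftedTelescope hb0).mul_left (v - u)
  have hterm : ∀ k : ℕ, densGap u v (k + K) = (v - u) / ((((k + K : ℕ) : ℝ) + u) * (((k + K : ℕ) : ℝ) + v)) := by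
    intro k
    have h1 : (((k + K : ℕ) : ℝ) + u) ≠ 0 := by positivity
    have h2 : (((k + K : ℕ) : ℝ) + v) ≠ 0 := by positivity
    rw [densGap, div_sub_div _ _ h1 h2, one_mul, mul_one]
    ring_nf
  have htel : ∀ (c : ℝ) (k : ℕ), 0 < c →
      1 / ((k : ℝ) + c) - 1 / ((k : ℝ) + c + 1) = 1 / (((k : ℝ) + c) * ((k : ℝ) + c + 1)) := by
    intro c k hc
    have h1 : (k : ℝ) + c ≠ 0 := by positivity
    have h2 : (k : ℝ) + c + 1 ≠ 0 := by positivity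
    rw [div_sub_div _ _ h1 h2, one_mul, mul_one]
    ring_nf
  constructor
  · refine hasSum_le (fun k => ?_) hga hf
    rw [hterm, htel a k ha0, div_eq_mul_one_div (v - u)]
    refine mul_le_mul_of_nonneg_left (one_div_le_one_div_of_le (by positivity) ?_) (by linarith)
    have hX : (K : ℝ) ≤ ((k + K : ℕ) : ℝ) := by push_cast; linarith [Nat.cast_nonneg (α := ℝ) k]
    have hsX : s * K ≤ s * ((k + K : ℕ) : ℝ) := mul_le_mul_of_nonneg_left hX hs0.le
    rw [ha]
    push_cast at hX hsX ⊢
    nlinarith [sq_nonneg (v - u), mul_nonneg hs0.le hu0.le, mul_nonneg hs0.le hv0.le, sq_nonneg s, hsX, hsK]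
  · refine hasSum_le (fun k => ?_) hf hgb
    rw [hterm, htel b k hb0, div_eq_mul_one_div (v - u)]
    refine mul_le_mul_of_nonneg_left (one_div_le_one_div_of_le (by positivity) ?_) (by linarith)
    rw [hb]
    push_cast
    nlinarith [hw, hvu0, Nat.cast_nonneg (α := ℝ) k]

/-- **Enclosure of `Σ_k densGap u v k = ψ(v) − ψ(u)`** from the exact partial sum to `K` and the tail sandwich. -/
theorem tsum_densGap_mem {u v : ℝ} (hu0 : 0 < u) (huv : u < v) (hv1 : v ≤ u + 1) {K : ℕ} (hK : 0 < K)
    {lo hi : ℝ}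
    (hlo : lo ≤ ∑ k ∈ range K, densGap u v k + (v - u) * (1 / ((K : ℝ) + (u + v) / 2 - 1 / 2 + 1 / (8 * K))))
    (hhi : ∑ k ∈ range K, densGap u v k + (v - u) * (1 / ((K : ℝ) + (u + v) / 2 - 1 / 2)) ≤ hi) :
    lo ≤ ∑' k : ℕ, densGap u v k ∧ ∑' k : ℕ, densGap u v k ≤ hi := by
  have hsplit : ∑ k ∈ range K, densGap u v k + ∑' k : ℕ, densGap u v (k + K) = ∑' k : ℕ, densGap u v k :=
    (summable_densGap hu0 huv hv1).sum_add_tsum_nat_add K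
  have ht := densGap_tail_sandwich hu0 huv hv1 K hK
  constructor <;> linarith [ht.1, ht.2]

/-! ### The digit table of `φ` at (6,5,4,7 | 0,1,2,12) -/

/-- The 7 intervals `[uᵢ, vᵢ)`: `i = 0..2` are the components of `{φ ≥ 1}`, `i = 3..6` those of `{φ = 2}`;
indices `≥ 7` are junk `(1/2, 1)` (never used). -/
def ivlA : ℕ → ℝ × ℝ
  | 0 => (1/7, 1/6) | 1 => (1/5, 1/2) | 2 => (3/5, 7/8)
  | 3 => (1/5, 1/4) | 4 => (2/5, 1/2) | 5 => (3/5, 5/8) | 6 => (4/5, 5/6) | _ => (1/2, 1)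

/-- Every interval satisfies `1/7 ≤ u < v ≤ 1`. -/
theorem ivlA_wf (i : ℕ) : 1/7 ≤ (ivlA i).1 ∧ (ivlA i).1 < (ivlA i).2 ∧ (ivlA i).2 ≤ 1 := by
  unfold ivlA; split <;> norm_num

/-- `0 < uᵢ`. -/
theorem ivlA_pos (i : ℕ) : 0 < (ivlA i).1 := lt_of_lt_of_le (by norm_num) (ivlA_wf i).1

/-- `uᵢ < vᵢ`. -/
theorem ivlA_lt (i : ℕ) : (ivlA i).1 < (ivlA i).2 := (ivlA_wf i).2.1

/-- `vᵢ ≤ 1`. -/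
theorem ivlA_le_one (i : ℕ) : (ivlA i).2 ≤ 1 := (ivlA_wf i).2.2

/-- `vᵢ ≤ uᵢ + 1`. -/
theorem ivlA_le_add_one (i : ℕ) : (ivlA i).2 ≤ (ivlA i).1 + 1 := by linarith [ivlA_le_one i, ivlA_pos i]

/-- The prime cut `p ≤ 7n` (`φ = 0` on `[0, 1/7)`; Lemma 7 uses `p ≤ γ₂ n = 7n`). -/
def primeCutA (n : ℕ) : ℕ := 7 * n

/-- The cut dominates `n/uᵢ`. -/
theorem div_le_primeCutA (i n : ℕ) : (n : ℝ) / (ivlA i).1 ≤ (primeCutA n : ℝ) := by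
  rw [div_le_iff₀ (ivlA_pos i), primeCutA]
  push_cast
  nlinarith [(ivlA_wf i).1, Nat.cast_nonneg (α := ℝ) n]

/-! ### The saving product `Φₙ` and its rate -/

/-- The class-prime product of ONE interval: `∏ {p prime : p ≤ 7n, 8n < p², uᵢ ≤ {n/p} < vᵢ}`. -/
def ivlProductA (i n : ℕ) : ℕ := classPrimeProduct 8 primeCutA {ivlA i} n

/-- **`Φₙ`** at rung A: `∏_{i<7} ivlProductA i n = ∏_{√(8n) < p ≤ 7n} p^{φ(n/p)}`. -/
def savingProductA (n : ℕ) : ℕ := ∏ i ∈ range 7, ivlProductA i n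

/-- The rate of one interval: `Σ_{k≥0} (1/(k+uᵢ) − 1/(k+vᵢ)) = ψ(vᵢ) − ψ(uᵢ)`. -/
def ivlRateA (i : ℕ) : ℝ := ∑' k : ℕ, densGap (ivlA i).1 (ivlA i).2 k

/-- **The saving rate** `∫ φ dψ = Σ_{i<7} ivlRateA i` (`= 6.91563523…`, `savingRateA_bounds`). -/
def savingRateA : ℝ := ∑ i ∈ range 7, ivlRateA i

/-- `ivlProductA i n > 0`. -/
theorem ivlProductA_pos (i n : ℕ) : 0 < ivlProductA i n := classPrimeProduct_pos _ _ _ _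

/-- `Φₙ > 0`. -/
theorem savingProductA_pos (n : ℕ) : 0 < savingProductA n := prod_pos fun i _ => ivlProductA_pos i n

/-- Rate of one interval (tree: `RhinViola.tendsto_log_classPrimeProduct_div`). -/
theorem tendsto_log_ivlProductA_div (i : ℕ) :
    Tendsto (fun n : ℕ => Real.log (ivlProductA i n) / n) atTop (𝓝 (ivlRateA i)) := by
  have h := tendsto_log_classPrimeProduct_div (C := 8) (by norm_num) primeCutA {ivlA i}
    (fun I hI => by rw [mem_singleton] at hI; subst hI; exact ⟨ivlA_pos i, ivlA_lt i, ivlA_le_one i⟩)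
    (fun I hI n => by rw [mem_singleton] at hI; subst hI; exact div_le_primeCutA i n)
    (fun I hI I' hI' hne => by
      rw [mem_singleton] at hI hI'; exact absurd (hI.trans hI'.symm) hne)
  simpa only [sum_singleton, ivlProductA, ivlRateA, densGap] using h

/-- **Rate of `Φₙ`**: `(1/n) log Φₙ → savingRateA`. -/
theorem tendsto_log_savingProductA_div :
    Tendsto (fun n : ℕ => Real.log (savingProductA n) / n) atTop (𝓝 savingRateA) := by
  have h := tendsto_finsetSum (range 7) fun i (_ : i ∈ range 7) => tendsto_log_ivlProductA_div i
  refine h.congr fun n => ?_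
  have hne : ∀ i ∈ range 7, ((ivlProductA i n : ℕ) : ℝ) ≠ 0 := fun i _ => by
    exact_mod_cast (ivlProductA_pos i n).ne'
  rw [savingProductA, Nat.cast_prod, Real.log_prod hne, sum_div]

/-- **Rate of the normaliser `D₇ₙ² / Φₙ`**: `(1/n) log (D₇ₙ D₇ₙ / Φₙ) → 14 − savingRateA`. -/
theorem tendsto_log_lcmNormaliserA_div :
    Tendsto (fun n : ℕ => Real.log (((Nat.lcmUpto (7 * n) : ℝ) * Nat.lcmUpto (7 * n)) /
        savingProductA n) / n) atTop (𝓝 (14 - savingRateA)) := by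
  have h1 := ViolaZudilin.tendsto_log_lcmUpto_mul_lcmUpto_div (a := 7) (b := 7) (by norm_num) (by norm_num)
  have h2 := tendsto_log_savingProductA_div
  have e : ((7 : ℕ) : ℝ) + (7 : ℕ) - savingRateA = 14 - savingRateA := by norm_num
  rw [← e]
  refine (h1.sub h2).congr fun n => ?_
  have hd : ((Nat.lcmUpto (7 * n) : ℝ) * Nat.lcmUpto (7 * n)) ≠ 0 := by
    have := Nat.lcmUpto_pos (7 * n)
    positivity
  have hΦ : (savingProductA n : ℝ) ≠ 0 := by exact_mod_cast (savingProductA_pos n).ne'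
  rw [Real.log_div hd hΦ, sub_div]

/-! ### Certified enclosure of the saving rate -/

/-- Enclosure of one interval's rate. -/
theorem ivlRateA_mem (i : ℕ) {K : ℕ} (hK : 0 < K) {lo hi : ℝ}
    (hlo : lo ≤ ∑ k ∈ range K, densGap (ivlA i).1 (ivlA i).2 k + ((ivlA i).2 - (ivlA i).1) *
      (1 / ((K : ℝ) + ((ivlA i).1 + (ivlA i).2) / 2 - 1 / 2 + 1 / (8 * K))))
    (hhi : ∑ k ∈ range K, densGap (ivlA i).1 (ivlA i).2 k + ((ivlA i).2 - (ivlA i).1) *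
      (1 / ((K : ℝ) + ((ivlA i).1 + (ivlA i).2) / 2 - 1 / 2)) ≤ hi) :
    lo ≤ ivlRateA i ∧ ivlRateA i ≤ hi :=
  tsum_densGap_mem (ivlA_pos i) (ivlA_lt i) (ivlA_le_add_one i) hK hlo hhi

/-- **Certified enclosure `6.91559 ≤ ∫ φ dψ ≤ 6.9157`** (`K = 10`; model value `6.91563523…`). -/
theorem savingRateA_bounds : (6.91559 : ℝ) ≤ savingRateA ∧ savingRateA ≤ 6.9157 := by
  have h0 := ivlRateA_mem 0 (K := 10) (by norm_num) (lo := 1.0318517) (hi := 1.031855)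
    (by norm_num [ivlA, densGap, sum_range_succ, sum_range_zero])
    (by norm_num [ivlA, densGap, sum_range_succ, sum_range_zero])
  have h1 := ivlRateA_mem 1 (K := 10) (by norm_num) (lo := 3.3255149) (hi := 3.3255536)
    (by norm_num [ivlA, densGap, sum_range_succ, sum_range_zero])
    (by norm_num [ivlA, densGap, sum_range_succ, sum_range_zero])
  have h2 := ivlRateA_mem 2 (K := 10) (by norm_num) (lo := 0.736589) (hi := 0.7366219)
    (by norm_num [ivlA, densGap, sum_range_succ, sum_range_zero])
    (by norm_num [ivlA, densGap, sum_range_succ, sum_range_zero])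
  have h3 := ivlRateA_mem 3 (K := 10) (by norm_num) (lo := 1.0615842) (hi := 1.0615909)
    (by norm_num [ivlA, densGap, sum_range_succ, sum_range_zero])
    (by norm_num [ivlA, densGap, sum_range_succ, sum_range_zero])
  have h4 := ivlRateA_mem 4 (K := 10) (by norm_num) (lo := 0.5978702) (hi := 0.5978829)
    (by norm_num [ivlA, densGap, sum_range_succ, sum_range_zero])
    (by norm_num [ivlA, densGap, sum_range_succ, sum_range_zero])
  have h5 := ivlRateA_mem 5 (K := 10) (by norm_num) (lo := 0.0879094) (hi := 0.0879125)
    (by norm_num [ivlA, densGap, sum_range_succ, sum_range_zero])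
    (by norm_num [ivlA, densGap, sum_range_succ, sum_range_zero])
  have h6 := ivlRateA_mem 6 (K := 10) (by norm_num) (lo := 0.0742777) (hi := 0.0742817)
    (by norm_num [ivlA, densGap, sum_range_succ, sum_range_zero])
    (by norm_num [ivlA, densGap, sum_range_succ, sum_range_zero])
  simp only [savingRateA, sum_range_succ, sum_range_zero, zero_add]
  constructor
  · linarith [h0.1, h1.1, h2.1, h3.1, h4.1, h5.1, h6.1]
  · linarith [h0.2, h1.2, h2.2, h3.2, h4.2, h5.2, h6.2]

/-- `savingRateA < 14 = 7 + 7`: the saving is a proper part of the normaliser `D₇ₙ²`. -/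
theorem savingRateA_lt : savingRateA < 14 := by linarith [savingRateA_bounds.2]

end Summit.KontsevichZagierPeriods.Zeta5Search.Denom.TwoTaleR3Saving

end
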